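import Mathlib
import Summits.NavierStokesRegularity.NavierStokesRegularity.Theorems.FilamentSkeletonRssStadiumSourceHolomorphic
import Summits.NavierStokesRegularity.NavierStokesRegularity.Theorems.FilamentSkeletonRssStadiumPartnerPiece

/-!
# Route `FilamentSkeletonRss` · cruxes `SkeletonJ1L` (stmt-NavierStokesRegularity-23296, registered stub `stub_tangentSkeletonL` ≡
# `TangentSkeletonNearStraightL`, stmt-23320) · line `child_tangent_analytic_strip_L` (b0b56c52900dd90a), stub `stub_stripPropagation` —
# brick for the freeze step of `rcore`: THE SOURCE TUBE AROUND A SEGMENT OF THE ANCHOR'S TENT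

Input of the tube deformation `Theorems.StadiumSegmentTube.segmentIntegral_tube_shift` (replace the segment `[p, q]` of the tent of the
anchor `z₀` by the segment `[p', q']` of the tent of a nearby target `z`): the matched kernel must be holomorphic IN THE SOURCE on the open
`δ`-discs about every point of `[p, q]`, for the target `z`.  From the POSITIVITY-form corner certificates at the anchor alone
(`0 < Re(Σᵢ (Fᵢ z₀ − Fᵢ ζ)² + κ·G ζ)` for `ζ` on `[p, q]`), by compactness of `{z₀} × [p, q]` in `ℂ × ℂ` and continuity of
`(z, ζ) ↦ Re(Σᵢ (Fᵢ z − Fᵢ ζ)² + κ·G ζ)` on `S × S` (a uniform thickening of a compact set stays inside an open superlevel set,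
`IsCompact.exists_thickening_subset_open`):
* `anchor_tube_margin` — some `m > 0`, `δ > 0` with `B(z₀, δ) ⊆ S` and `m ≤ Re(Σᵢ (Fᵢ z − Fᵢ ζ)² + κ·G ζ)`, `ζ ∈ S`, for every target
  `z ∈ B(z₀, δ)`, `t ∈ [0,1]` and source `ζ ∈ B(p + t(q − p), δ)`;
* `isOpen_posSet`, `kernel_source_differentiableOn` — for every target `z ∈ S` the principal-branch set
  `Ω_z = {ζ ∈ S | 0 < Re(Σᵢ (Fᵢ z − Fᵢ ζ)² + κ·G ζ)}` is open and the kernel `ζ ↦ ((Σᵢ (Fᵢ z − Fᵢ ζ)² + κ G ζ)^{3/2})⁻¹ • (F′ ζ ⨯₃ (F z − F ζ))`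
  is holomorphic on it (`Theorems.StadiumSourceHolomorphic`);
* `anchor_tube` — the package: `B(p + t(q−p), δ) ⊆ Ω_z` for all `z ∈ B(z₀, δ)`, `t ∈ [0,1]` (exactly `htube` of `segmentIntegral_tube_shift`
  with `U = Ω_z`, `f` = the kernel of target `z`).
Stadium `S = {|Im| < hs, |Re − cc| < L + hs}`, `F`, `G` holomorphic on `S`; no numbers, no tangent-oscillation input.
HONEST FRAMING: a brick for a plan about a HYPOTHETICAL filament skeleton on the NEGATIVE side of a MODEL route; the stub `stub_stripPropagation`
is NOT closed by this file, `TangentSkeletonNearStraightL` / `SkeletonJ1L` stay OPEN; nothing here bears on Navier–Stokes regularity or blow-up.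
`--supports stmt-NavierStokesRegularity-23320` (≡ stub `stub_tangentSkeletonL` of 23296).
-/

set_option linter.dupNamespace false

noncomputable section

namespace Summit.NavierStokesRegularity.NavierStokesRegularity.Theorems.StadiumAnchorTube

open Set Filter Topology Complex Metric
open scoped Matrix
open Summit.NavierStokesRegularity.NavierStokesRegularity.Theorems.StadiumSourceHolomorphic
open Summit.NavierStokesRegularity.NavierStokesRegularity.Theorems.StadiumPartnerPiece

/-- **The source tube around a segment of the anchor's tent.**  `F` holomorphic and `G` continuous on the stadium `S`, anchor `z₀ ∈ S`,
segment `t ↦ p + t(q − p)` (`t ∈ [0,1]`) inside `S`, pointwise positivity at the anchor.  Then for some `m, δ > 0`: `B(z₀, δ) ⊆ S`, and for all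
targets `z ∈ B(z₀, δ)`, all `t ∈ [0,1]` and all sources `ζ ∈ B(p + t(q−p), δ)`: `ζ ∈ S` and `m ≤ Re(Σᵢ (Fᵢ z − Fᵢ ζ)² + κ·G ζ)`. [folklore] -/
theorem anchor_tube_margin {hs L cc : ℝ} {F : ℂ → (Fin 3 → ℂ)}
    (hF : DifferentiableOn ℂ F {z : ℂ | |z.im| < hs ∧ |z.re - cc| < L + hs})
    {G : ℂ → ℂ} (hG : ContinuousOn G {z : ℂ | |z.im| < hs ∧ |z.re - cc| < L + hs})
    {p q z₀ : ℂ} (hz₀ : z₀ ∈ {z : ℂ | |z.im| < hs ∧ |z.re - cc| < L + hs})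
    (hseg : ∀ t ∈ Icc (0:ℝ) 1, p + (t : ℂ) * (q - p) ∈ {z : ℂ | |z.im| < hs ∧ |z.re - cc| < L + hs})
    {κ : ℝ}
    (hpos : ∀ t ∈ Icc (0:ℝ) 1,
      0 < ((∑ i, (F z₀ i - F (p + (t : ℂ) * (q - p)) i) ^ 2) + (κ : ℂ) * G (p + (t : ℂ) * (q - p))).re) :
    ∃ m δ : ℝ, 0 < m ∧ 0 < δ ∧ ball z₀ δ ⊆ {z : ℂ | |z.im| < hs ∧ |z.re - cc| < L + hs} ∧
      ∀ z ∈ ball z₀ δ, ∀ t ∈ Icc (0:ℝ) 1, ∀ ζ ∈ ball (p + (t : ℂ) * (q - p)) δ,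
        ζ ∈ {z : ℂ | |z.im| < hs ∧ |z.re - cc| < L + hs} ∧ m ≤ ((∑ i, (F z i - F ζ i) ^ 2) + (κ : ℂ) * G ζ).re := by
  set S : Set ℂ := {z : ℂ | |z.im| < hs ∧ |z.re - cc| < L + hs} with hS
  have hSo : IsOpen S := isOpen_stadium hs (L + hs) cc
  -- the joint function `Ψ(z, ζ)`
  set Ψ : ℂ × ℂ → ℝ := fun x => ((∑ i, (F x.1 i - F x.2 i) ^ 2) + (κ : ℂ) * G x.2).re with hΨ
  have hΨc : ContinuousOn Ψ (S ×ˢ S) := by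
    have h1 : ContinuousOn (fun x : ℂ × ℂ => F x.1) (S ×ˢ S) :=
      hF.continuousOn.comp continuous_fst.continuousOn (fun x hx => hx.1)
    have h2 : ContinuousOn (fun x : ℂ × ℂ => F x.2) (S ×ˢ S) :=
      hF.continuousOn.comp continuous_snd.continuousOn (fun x hx => hx.2)
    have h3 : ContinuousOn (fun x : ℂ × ℂ => G x.2) (S ×ˢ S) :=
      hG.comp continuous_snd.continuousOn (fun x hx => hx.2)
    have h4 : ContinuousOn (fun x : ℂ × ℂ => ∑ i, (F x.1 i - F x.2 i) ^ 2) (S ×ˢ S) := by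
      refine continuousOn_finsetSum _ fun i _ => ?_
      exact (((continuous_apply i).comp_continuousOn h1).sub ((continuous_apply i).comp_continuousOn h2)).pow 2
    exact Complex.continuous_re.comp_continuousOn (h4.add (continuousOn_const.mul h3))
  -- the compact anchor set `{z₀} × [p, q]`
  set γ : ℝ → ℂ := fun t => p + (t : ℂ) * (q - p) with hγ
  have hγc : Continuous γ := continuous_const.add (Complex.continuous_ofReal.mul continuous_const)
  set Kset : Set (ℂ × ℂ) := (fun t : ℝ => (z₀, γ t)) '' Icc (0:ℝ) 1 with hKset
  have hKc : IsCompact Kset := isCompact_Icc.image (continuous_const.prodMk hγc)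
  have hKS : Kset ⊆ S ×ˢ S := by
    rintro _ ⟨t, ht, rfl⟩
    exact ⟨hz₀, hseg t ht⟩
  have hKne : Kset.Nonempty := ⟨(z₀, γ 0), ⟨0, ⟨le_rfl, zero_le_one⟩, rfl⟩⟩
  obtain ⟨x₀, hx₀K, hx₀min⟩ := hKc.exists_isMinOn hKne (hΨc.mono hKS)
  obtain ⟨t₀, ht₀, hx₀eq⟩ := hx₀K
  have hm0 : 0 < Ψ x₀ := by
    rw [← hx₀eq]
    exact hpos t₀ ht₀
  -- the open superlevel set and a uniform thickening of the anchor set inside it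
  set U : Set (ℂ × ℂ) := (S ×ˢ S) ∩ Ψ ⁻¹' (Ioi (Ψ x₀ / 2)) with hU
  have hUo : IsOpen U := hΨc.isOpen_inter_preimage (hSo.prod hSo) isOpen_Ioi
  have hKU : Kset ⊆ U := by
    intro x hx
    refine ⟨hKS hx, ?_⟩
    show Ψ x₀ / 2 < Ψ x
    have := (isMinOn_iff.mp hx₀min) x hx
    linarith
  obtain ⟨δ, hδ, hthick⟩ := hKc.exists_thickening_subset_open hUo hKU
  refine ⟨Ψ x₀ / 2, δ, half_pos hm0, hδ, ?_, ?_⟩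
  · intro z hz
    have hmem : (z, γ 0) ∈ thickening δ Kset := by
      rw [mem_thickening_iff]
      refine ⟨(z₀, γ 0), ⟨0, ⟨le_rfl, zero_le_one⟩, rfl⟩, ?_⟩
      rw [Prod.dist_eq, dist_self]
      exact max_lt (mem_ball.mp hz) hδ
    exact (hthick hmem).1.1
  · intro z hz t ht ζ hζ
    have hmem : (z, ζ) ∈ thickening δ Kset := by
      rw [mem_thickening_iff]
      refine ⟨(z₀, γ t), ⟨t, ht, rfl⟩, ?_⟩
      rw [Prod.dist_eq]
      exact max_lt (mem_ball.mp hz) (mem_ball.mp hζ)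
    have hU' := hthick hmem
    exact ⟨hU'.1.2, le_of_lt hU'.2⟩

/-- The principal-branch source set of a target `z`, `Ω_z = {ζ ∈ S | 0 < Re(Σᵢ (Fᵢ z − Fᵢ ζ)² + κ·G ζ)}`, is open (`F`, `G` continuous on
the open stadium). [folklore] -/
theorem isOpen_posSet {hs L cc : ℝ} {F : ℂ → (Fin 3 → ℂ)}
    (hF : DifferentiableOn ℂ F {z : ℂ | |z.im| < hs ∧ |z.re - cc| < L + hs})
    {G : ℂ → ℂ} (hG : ContinuousOn G {z : ℂ | |z.im| < hs ∧ |z.re - cc| < L + hs}) (z : ℂ) (κ : ℝ) :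
    IsOpen {ζ : ℂ | ζ ∈ {z : ℂ | |z.im| < hs ∧ |z.re - cc| < L + hs} ∧
      0 < ((∑ i, (F z i - F ζ i) ^ 2) + (κ : ℂ) * G ζ).re} := by
  set S : Set ℂ := {z : ℂ | |z.im| < hs ∧ |z.re - cc| < L + hs} with hS
  have hSo : IsOpen S := isOpen_stadium hs (L + hs) cc
  have hc : ContinuousOn (fun ζ => ((∑ i, (F z i - F ζ i) ^ 2) + (κ : ℂ) * G ζ).re) S := by
    have h4 : ContinuousOn (fun ζ => ∑ i, (F z i - F ζ i) ^ 2) S := by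
      refine continuousOn_finsetSum _ fun i _ => ?_
      exact (continuousOn_const.sub ((continuous_apply i).comp_continuousOn hF.continuousOn)).pow 2
    exact Complex.continuous_re.comp_continuousOn (h4.add (continuousOn_const.mul hG))
  exact hc.isOpen_inter_preimage hSo isOpen_Ioi

/-- For every target `z`, the kernel `ζ ↦ ((Σᵢ (Fᵢ z − Fᵢ ζ)² + κ G ζ)^{3/2})⁻¹ • (F′ ζ ⨯₃ (F z − F ζ))` is holomorphic in the source on
`Ω_z` (`F`, `G` holomorphic on the stadium; `Theorems.StadiumSourceHolomorphic.differentiableOn_kernel_source`). [folklore] -/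
theorem kernel_source_differentiableOn {hs L cc : ℝ} {F : ℂ → (Fin 3 → ℂ)}
    (hF : DifferentiableOn ℂ F {z : ℂ | |z.im| < hs ∧ |z.re - cc| < L + hs})
    {G : ℂ → ℂ} (hG : DifferentiableOn ℂ G {z : ℂ | |z.im| < hs ∧ |z.re - cc| < L + hs}) (z : ℂ) (κ : ℝ) :
    DifferentiableOn ℂ (fun ζ => (((∑ i, (F z i - F ζ i) ^ 2) + (κ : ℂ) * G ζ) ^ ((3:ℂ) / 2))⁻¹ •
        (deriv F ζ ⨯₃ (fun i => F z i - F ζ i)))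
      {ζ : ℂ | ζ ∈ {z : ℂ | |z.im| < hs ∧ |z.re - cc| < L + hs} ∧ 0 < ((∑ i, (F z i - F ζ i) ^ 2) + (κ : ℂ) * G ζ).re} := by
  have hΩ := isOpen_posSet hF hG.continuousOn z κ
  exact differentiableOn_kernel_source hΩ (hF.mono fun ζ hζ => hζ.1) (hG.mono fun ζ hζ => hζ.1) z (fun ζ hζ => hζ.2)

/-- **The package for the tube deformation.**  `F`, `G` holomorphic on the stadium `S`, anchor `z₀ ∈ S`, segment `[p, q] ⊆ S`, pointwise
positivity at the anchor along the segment.  Then for some `δ > 0` with `B(z₀, δ) ⊆ S`: for every target `z ∈ B(z₀, δ)` the kernel of target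
`z` is holomorphic in the source on the open set `Ω_z`, and the `δ`-discs about every point of `[p, q]` lie in `Ω_z` — the hypotheses
`hf`, `htube` of `Theorems.StadiumSegmentTube.segmentIntegral_tube_shift` for the frozen segment and the target `z`. [folklore] -/
theorem anchor_tube {hs L cc : ℝ} {F : ℂ → (Fin 3 → ℂ)}
    (hF : DifferentiableOn ℂ F {z : ℂ | |z.im| < hs ∧ |z.re - cc| < L + hs})
    {G : ℂ → ℂ} (hG : DifferentiableOn ℂ G {z : ℂ | |z.im| < hs ∧ |z.re - cc| < L + hs})
    {p q z₀ : ℂ} (hz₀ : z₀ ∈ {z : ℂ | |z.im| < hs ∧ |z.re - cc| < L + hs})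
    (hseg : ∀ t ∈ Icc (0:ℝ) 1, p + (t : ℂ) * (q - p) ∈ {z : ℂ | |z.im| < hs ∧ |z.re - cc| < L + hs})
    {κ : ℝ}
    (hpos : ∀ t ∈ Icc (0:ℝ) 1,
      0 < ((∑ i, (F z₀ i - F (p + (t : ℂ) * (q - p)) i) ^ 2) + (κ : ℂ) * G (p + (t : ℂ) * (q - p))).re) :
    ∃ m δ : ℝ, 0 < m ∧ 0 < δ ∧ ball z₀ δ ⊆ {z : ℂ | |z.im| < hs ∧ |z.re - cc| < L + hs} ∧
      ∀ z ∈ ball z₀ δ,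
        DifferentiableOn ℂ (fun ζ => (((∑ i, (F z i - F ζ i) ^ 2) + (κ : ℂ) * G ζ) ^ ((3:ℂ) / 2))⁻¹ •
            (deriv F ζ ⨯₃ (fun i => F z i - F ζ i)))
          {ζ : ℂ | ζ ∈ {z : ℂ | |z.im| < hs ∧ |z.re - cc| < L + hs} ∧ 0 < ((∑ i, (F z i - F ζ i) ^ 2) + (κ : ℂ) * G ζ).re} ∧
        (∀ t ∈ Icc (0:ℝ) 1, ball (p + (t : ℂ) * (q - p)) δ ⊆
          {ζ : ℂ | ζ ∈ {z : ℂ | |z.im| < hs ∧ |z.re - cc| < L + hs} ∧ 0 < ((∑ i, (F z i - F ζ i) ^ 2) + (κ : ℂ) * G ζ).re}) ∧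
        (∀ t ∈ Icc (0:ℝ) 1, ∀ ζ ∈ ball (p + (t : ℂ) * (q - p)) δ, m ≤ ((∑ i, (F z i - F ζ i) ^ 2) + (κ : ℂ) * G ζ).re) := by
  obtain ⟨m, δ, hm, hδ, hball, htube⟩ := anchor_tube_margin hF hG.continuousOn hz₀ hseg hpos
  refine ⟨m, δ, hm, hδ, hball, fun z hz => ⟨kernel_source_differentiableOn hF hG z κ, ?_, ?_⟩⟩
  · intro t ht ζ hζ
    have h := htube z hz t ht ζ hζ
    exact ⟨h.1, lt_of_lt_of_le hm h.2⟩
  · intro t ht ζ hζ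
    exact (htube z hz t ht ζ hζ).2

end Summit.NavierStokesRegularity.NavierStokesRegularity.Theorems.StadiumAnchorTube

end
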